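import Summits.BirchSwinnertonDyer.Rank1Residual.X4.KuriharaClasswide
import HarnessLib

/-!
# Classes X3/X4 (additive `p`): Kim's Kurihara-number route in analytic rank `1`, and the X3 gap
# (cell `b2b-bsdres`, unit `b2b-bsdres-additive-p3`; sibling of `X4/KuriharaClasswide.lean`)

HONEST FRAMING (run/shared/lean/b2b/bsd-rank1-residual/, verbatim in every file): the goal of the
cell is to DELETE the COMBINATION-SHAPED residual classes of the Birch–Swinnerton-Dyer formula for
ALL analytic-rank `≤ 1` elliptic curves over `ℚ` — "full BSD formula for every rank `≤ 1` curve in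
class `C`" assembled STRICTLY from published theorems — so that the rank-`≤ 1` remainder becomes
exactly the CONSTRUCTION-SHAPED classes, which are TYPED (missing-input `Prop`s), NOT attempted.
This is not "finishing BSD". Research route; no claim beyond the stated classes. X3 and X4 stay
CONSTRUCTION-SHAPED; nothing below is a class theorem closing either.

Theorems only (no definition, no named fact). See the module docstring of
`X4/KuriharaClasswide.lean` for the class-wide reading (Kim 2026 Thm. 1.10: on
`X4 ∧ p ≥ 5 ∧ surj ∧ Manin ∧ E(ℚ_p)[p] = 0 ∧ p ∤ ∏ c_ℓ` the Kurihara-unit criterion holds for every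
member iff Kato's IMC holds for every member) and for the typed inputs `KuriharaUnitAt` /
`KuriharaUnitPrimeAt`. Here:

* **Analytic rank `1`, ANY reduction at `p` (additive included)**: Kim 2026 Thm. 1.8 (1), (4), (6)
  in its any-reduction rank-one shape (tree named fact
  `Kim2022_rankOne_card_sha_eq_one_of_kuriharaNumber_ne_zero_of_maninConstant`, harvest-2 gen 5,
  referee F56/R82.4): ONE unit Kurihara number at a PRIME cyclic Kolyvagin level gives
  `#Ш(E/ℚ)(p) = 1`; hence, with Gross–Zagier–Kolyvagin, Miller's `BSD(E,p)` holds IFF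
  `ord_p #Ш_an = 0` (`bsdp_iff_padicValRat_eq_zero_of_kim_rankOne`) — exact: the remaining input is
  the VALUE `ord_p #Ш_an` (two engines per pair), not a class statement (nothing in print relates
  `∂^{(1)}(δ̃)` to `L'(E,1)/(Ω·Reg)` at an additive prime: no `p`-adic Gross–Zagier / control
  there, Kim–Nakamura 2020 Rem. 1.8 (3)). Consumer `bsdp_of_kim_rankOne_of_maninConstant` (the 26
  open rank-`1` X4 census pairs at `p ∈ {5,7}` with `ρ̄` onto, `p ∤ ∏ c_ℓ · #Ш_an`, harvest-2 E21.3),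
  census shapes over `ClassX4` and `KuriharaUnitPrimeAt`.
* **Located gap X3** (`X3.not_surj`, `X3.kim_hypotheses_unsatisfiable`): every printed
  Kurihara-number theorem (Kim 2026 Thm. 1.8/1.10, Cor. 1.6; Kim–Nakamura 2020 Thm. 1.6/1.7;
  Kim–Kim–Sun 2020; Sakamoto 2022; Kurihara 2014) carries "`ρ̄` surjective"; on X3
  (`red(p) ∧ add(p)`) `E[p]` is reducible, so the route is EMPTY there — no statement, no
  certificate; X3 keeps the typed input `X3.MissingInputAt` of `Typed/X3.lean`.

References: [Kim2022StructureSelmer] Thm. 1.8, Thm. 1.10 (journal; = v4 Thm. 1.9, 1.11);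
[KimNakamura2020] Rem. 1.8 (3); [Miller2011LMS] Def. 1.1; cell files REFEREE.md R82.4,
b2b-bsdres-harvest-2/HARVEST.md E21.3.
-/

noncomputable section

open scoped Classical MatrixGroups ModularForm

open CongruenceSubgroup WeierstrassCurve Literature.NumberTheory.EllipticCurves
  Literature.NumberTheory.EllipticCurves.ModularForms
  Literature.NumberTheory.EllipticCurves.Rank1Residual
  Literature.NumberTheory.EllipticCurves.Rank1Residual.Typed

namespace Summit.BirchSwinnertonDyer.Rank1Residual.X4

variable (W : WeierstrassCurve ℚ) [W.IsElliptic] [W.IsGloballyMinimal] (p : ℕ) [Fact p.Prime]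


/-! ### §4 Analytic rank `1`: `Ш(E/ℚ)[p^∞] = 0` from a prime-level unit, `BSD(E,p) ⟺ ord_p #Ш_an = 0` -/

omit [W.IsElliptic] [W.IsGloballyMinimal] [Fact p.Prime] in
/-- **Bookkeeping behind the rank-one residue.** With `rank E(ℚ) = r_an`, `Ш(E/ℚ)` finite and
`#Ш(E/ℚ)(p) = 1` (the output of Kim's clause (6) at a prime-level unit), and the analytic order
`#Ш_an = q ∈ ℚ`: Miller's `BSD(E,p)` holds iff `ord_p q = 0`. Fact-free.
[cite: Miller2011LMS, Def. 1.1 (arXiv:1010.2431 p. 3)] -/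
theorem bsdp_iff_padicValRat_eq_zero_of_card_primaryComponent_eq_one
    (hmw : W.mordellWeilRank = W.analyticRank) (hfin : Finite W.sha)
    (hcard : Nat.card (AddCommGroup.primaryComponent W.sha p) = 1) {q : ℚ}
    (hq : shaAn W = (q : ℂ)) : BSDp W p ↔ padicValRat p q = 0 := by
  constructor
  · rintro ⟨-, -, q', hq', hv'⟩
    have hqq : q' = q := by exact_mod_cast hq'.symm.trans hq
    rw [hqq, hcard] at hv'
    simpa using hv'
  · intro hv
    haveI : Finite W.sha := hfin
    exact ⟨hmw, inferInstance, q, hq, by rw [hv, hcard]; simp⟩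

/-- **Rank-one residue of the Kurihara route, ANY reduction at `p` (additive included).** Inputs:
Kim 2026 Thm. 1.8 (1), (4), (6) in its any-reduction rank-`1` shape (named fact `hKim` =
`Kim2022_rankOne_card_sha_eq_one_of_kuriharaNumber_ne_zero_of_maninConstant`: a unit Kurihara number
at a PRIME cyclic Kolyvagin level gives `#Ш(E/ℚ)(p) = 1`) and Gross–Zagier–Kolyvagin (`hGZK`).
Hypotheses, per pair: `p ≥ 5`; `ρ̄_{E,p}` onto; `L(E,1) = 0`, `ord_{s=1} L(E,s) = 1`; the Manin
datum `D` with `p ∤ D.maninConstant`; the period transfer; the Kolyvagin prime `ℓ` with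
`#Ẽ(𝔽_ℓ)[p] ≤ p`, `ψ_ℓ` onto, `kuriharaNumber D.f p ℓ ψ ≠ 0`; and the analytic order `#Ш_an = q`.
Conclusion: `BSD(E,p) ⟺ ord_p q = 0` — exact; the remaining input is the VALUE `ord_p #Ш_an` (a
two-engine number per pair), not a class statement. Per pair; NOT a class theorem.
[cite: Kim2022StructureSelmer, Thm. 1.8 (1), (4), (6) (journal; = v4 Thm. 1.9)] [cite: Miller2011LMS, Def. 1.1] -/
theorem bsdp_iff_padicValRat_eq_zero_of_kim_rankOne
    (hKim : Kim2022_rankOne_card_sha_eq_one_of_kuriharaNumber_ne_zero_of_maninConstant)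
    (hGZK : rank_eq_analyticRank_of_analyticRank_le_one) (hp : 5 ≤ p)
    (hsurj : W.HasSurjectiveModNGaloisRep p) (hL : W.entireLFunction 1 = 0)
    (hr : W.analyticRank = 1)
    {N : ℕ} [NeZero N] (D : ModularParametrizationData W N) (hc : ¬ (p : ℤ) ∣ D.maninConstant)
    (hper : ∃ u : ℚ, ‖(u : ℚ_[p])‖ = 1 ∧ W.realPeriodRat = u * plusPeriod D.f)
    (ℓ : ℕ) [Fact ℓ.Prime] (hℓ : Kato.IsKolyvaginPrime W p 1 ℓ)
    (hcyc : Nat.card {P : ((WeierstrassCurve.integralModelInt W).map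
        (Int.castRingHom (ZMod ℓ))).toAffine.Point // p • P = 0} ≤ p)
    (ψ : (ℓ' : ℕ) → (ZMod ℓ')ˣ →* Multiplicative (ZMod (p ^ 1)))
    (hψ : Function.Surjective (ψ ℓ)) (hδ : kuriharaNumber D.f (p ^ 1) ℓ ψ ≠ 0)
    {q : ℚ} (hq : shaAn W = (q : ℂ)) : BSDp W p ↔ padicValRat p q = 0 := by
  obtain ⟨hmw, hfin⟩ := hGZK W (by rw [hr])
  have hcard := hKim W p hp hsurj hL hr hfin D hc hper ℓ hℓ hcyc ψ hψ hδ
  exact bsdp_iff_padicValRat_eq_zero_of_card_primaryComponent_eq_one W p hmw hfin hcard hq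

/-- **Rank-one consumer at ANY prime `p ≥ 5`, additive included**: the hypotheses of
`bsdp_iff_padicValRat_eq_zero_of_kim_rankOne` plus `ord_p #Ш_an = 0` give Miller's `BSD(E,p)`.
Where it bites: the 26 open rank-`1` X4 census pairs at `p ∈ {5, 7}` with `ρ̄` onto and
`p ∤ ∏ c_ℓ · #Ш_an` (harvest-2 E21.3; unit `δ̃_ℓ` at `ν = 1`). Per pair; NOT a class theorem.
[cite: Kim2022StructureSelmer, Thm. 1.8 (1), (4), (6) (journal)] [cite: Miller2011LMS, Def. 1.1] -/
theorem bsdp_of_kim_rankOne_of_maninConstant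
    (hKim : Kim2022_rankOne_card_sha_eq_one_of_kuriharaNumber_ne_zero_of_maninConstant)
    (hGZK : rank_eq_analyticRank_of_analyticRank_le_one) (hp : 5 ≤ p)
    (hsurj : W.HasSurjectiveModNGaloisRep p) (hL : W.entireLFunction 1 = 0)
    (hr : W.analyticRank = 1)
    {N : ℕ} [NeZero N] (D : ModularParametrizationData W N) (hc : ¬ (p : ℤ) ∣ D.maninConstant)
    (hper : ∃ u : ℚ, ‖(u : ℚ_[p])‖ = 1 ∧ W.realPeriodRat = u * plusPeriod D.f)
    (ℓ : ℕ) [Fact ℓ.Prime] (hℓ : Kato.IsKolyvaginPrime W p 1 ℓ)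
    (hcyc : Nat.card {P : ((WeierstrassCurve.integralModelInt W).map
        (Int.castRingHom (ZMod ℓ))).toAffine.Point // p • P = 0} ≤ p)
    (ψ : (ℓ' : ℕ) → (ZMod ℓ')ˣ →* Multiplicative (ZMod (p ^ 1)))
    (hψ : Function.Surjective (ψ ℓ)) (hδ : kuriharaNumber D.f (p ^ 1) ℓ ψ ≠ 0)
    {q : ℚ} (hq : shaAn W = (q : ℂ)) (hv : padicValRat p q = 0) : BSDp W p :=
  (bsdp_iff_padicValRat_eq_zero_of_kim_rankOne W p hKim hGZK hp hsurj hL hr D hc hper ℓ hℓ hcyc ψ hψ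
    hδ hq).mpr hv

/-- **X4 ∧ `r_an = 1`: `BSD(E,p) ⟺ ord_p #Ш_an = 0` given the typed input `KuriharaUnitPrimeAt`**
(census shape; modularity `hmod` reads `r_an = 1` as `L(E,1) = 0`). The additive clause of
`ClassX4` is carried to name the class, not used. NOT a class theorem.
[cite: Kim2022StructureSelmer, Thm. 1.8 (1), (4), (6), Thm. 1.10 (journal)] [cite: Miller2011LMS, Def. 1.1] -/
theorem bsdp_iff_padicValRat_eq_zero_of_kuriharaUnitPrimeAt_of_analyticRank_eq_one
    (hKim : Kim2022_rankOne_card_sha_eq_one_of_kuriharaNumber_ne_zero_of_maninConstant)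
    (hGZK : rank_eq_analyticRank_of_analyticRank_le_one) (hmod : hasEntireLFunction_rat)
    (hp : 5 ≤ p) (_hX : ClassX4 W p) (hsurj : Surj W p) (hr : W.analyticRank = 1)
    {N : ℕ} [NeZero N] (D : ModularParametrizationData W N) (hc : ¬ (p : ℤ) ∣ D.maninConstant)
    (hper : ∃ u : ℚ, ‖(u : ℚ_[p])‖ = 1 ∧ W.realPeriodRat = u * plusPeriod D.f)
    (hK : KuriharaUnitPrimeAt W p D.f) {q : ℚ} (hq : shaAn W = (q : ℂ)) :
    BSDp W p ↔ padicValRat p q = 0 := by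
  have hL : W.entireLFunction 1 = 0 := by
    by_contra hne
    have h0 := (W.analyticRank_eq_zero_iff_holds (hmod W)).mpr hne
    omega
  obtain ⟨ℓ, hℓF, hℓ, hcyc, ψ, hψ, hδ⟩ := hK
  exact bsdp_iff_padicValRat_eq_zero_of_kim_rankOne W p hKim hGZK hp hsurj hL hr D hc hper ℓ hℓ hcyc ψ
    hψ hδ hq

/-- **X4 ∧ `r_an = 1` ∧ `ord_p #Ш_an = 0`: `BSD(E,p)` from the typed input `KuriharaUnitPrimeAt`**
— the class-wide SHAPE of the route in analytic rank `1`. [cite: Kim2022StructureSelmer, Thm. 1.8 (1), (4), (6), Thm. 1.10 (journal)]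
[cite: Miller2011LMS, Def. 1.1] -/
theorem bsdp_of_kuriharaUnitPrimeAt_of_analyticRank_eq_one
    (hKim : Kim2022_rankOne_card_sha_eq_one_of_kuriharaNumber_ne_zero_of_maninConstant)
    (hGZK : rank_eq_analyticRank_of_analyticRank_le_one) (hmod : hasEntireLFunction_rat)
    (hp : 5 ≤ p) (hX : ClassX4 W p) (hsurj : Surj W p) (hr : W.analyticRank = 1)
    {N : ℕ} [NeZero N] (D : ModularParametrizationData W N) (hc : ¬ (p : ℤ) ∣ D.maninConstant)
    (hper : ∃ u : ℚ, ‖(u : ℚ_[p])‖ = 1 ∧ W.realPeriodRat = u * plusPeriod D.f)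
    (hK : KuriharaUnitPrimeAt W p D.f) {q : ℚ} (hq : shaAn W = (q : ℂ))
    (hv : padicValRat p q = 0) : BSDp W p :=
  (bsdp_iff_padicValRat_eq_zero_of_kuriharaUnitPrimeAt_of_analyticRank_eq_one W p hKim hGZK hmod hp
    hX hsurj hr D hc hper hK hq).mpr hv

end Summit.BirchSwinnertonDyer.Rank1Residual.X4

/-! ### §5 Class X3 (Eisenstein additive): the route is empty — located gap -/

namespace Summit.BirchSwinnertonDyer.Rank1Residual.X3

variable (W : WeierstrassCurve ℚ) [W.IsElliptic] [W.IsGloballyMinimal] (p : ℕ) [Fact p.Prime]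

omit [W.IsGloballyMinimal] in
/-- **X3 ⇒ `ρ̄_{E,p}` is not surjective** (`ClassX3 W p = red(p) ∧ add(p)`; a surjective `ρ̄` has
irreducible `E[p]`, tree theorem `hasIrreducibleModPGaloisRep_of_hasSurjectiveModNGaloisRep`).
[folklore] -/
theorem not_surj (hX : ClassX3 W p) : ¬ Surj W p := fun hsurj =>
  hX.1 (hasIrreducibleModPGaloisRep_of_hasSurjectiveModNGaloisRep W p hsurj)

omit [W.IsGloballyMinimal] in
/-- **Located gap X3**: the hypothesis "`ρ̄_{E,p}` surjective" of EVERY printed Kurihara-number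
theorem (Kim 2026 Thm. 1.8, Thm. 1.10, Cor. 1.6; Kim–Nakamura 2020 Thm. 1.6/1.7; Kim–Kim–Sun 2020;
Sakamoto 2022; Kurihara 2014) is unsatisfiable on class X3, so the tree's Kim facts
(`Kim2022_…_of_maninConstant`) have no instance there: the Kurihara route types NOTHING for X3
(which stays CONSTRUCTION-SHAPED with the typed input `X3.MissingInputAt` of `Typed/X3.lean`).
[cite: Kim2022StructureSelmer, Thm. 1.8 and Thm. 1.10 (journal), hypothesis "ρ̄ is surjective"] -/
theorem kim_hypotheses_unsatisfiable (hX : ClassX3 W p) (hsurj : Surj W p) : False :=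
  not_surj W p hX hsurj

end Summit.BirchSwinnertonDyer.Rank1Residual.X3

end
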